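import Summits.BirchSwinnertonDyer.Rank1Residual.GaloisImage.KuriharaRecordBSDpThreeLevelTwoEndNoRank
import Summits.BirchSwinnertonDyer.Rank1Residual.Additive.KuriharaNumberModulusReduction
import HarnessLib

/-!
# R1-61, part 4: the END-m2 record corollaries in the END-m1 / engine CURRENCY — the depth-one
# certificate as an ORDINARY mod-`3` Kurihara number `δ̃_n ≢ 0 (mod 3)` (r1 ROUTE-1 §35.6)
# (cell `b2b-bsdres`, team n1011, ROUTE-1 §33.3 / §35.6 / §36 R1-61; OWNERS row T-E2-REC; seat p18)

HONEST FRAMING (cell `b2b-bsdres`, run/shared/lean/b2b/bsd-rank1-residual/, verbatim in every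
file): the goal of the cell is to DELETE the COMBINATION-SHAPED residual classes of the
Birch–Swinnerton-Dyer formula for ALL analytic-rank `≤ 1` elliptic curves over `ℚ` — "full BSD
formula for every rank `≤ 1` curve in class `C`" assembled STRICTLY from published theorems — so
that the rank-`≤ 1` remainder becomes exactly the CONSTRUCTION-SHAPED classes, which are TYPED
(missing-input `Prop`s), NOT attempted. This is not "finishing BSD". Team n1011 (N10/N11, the
additive block `X4 ∧ p = 3`): research route; PER-PAIR record shape, NOT a class theorem; TOOL
theorems only (no definition, no named fact); nothing booked; no mark / label moved; the shapes
CLOSE NOTHING.  END-m2 is DEBT REDUCTION on class A2 (`BSD(E,3)` only where `ord₃(L(E,1)/Ω_E) ≤ 2`),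
not coverage: CONDITIONAL on the UPPER-half facts of the X4 chain of record, Cassels–Tate, the
Poitou–Tate family at `3` (or the named fact `hPT`), Tate's `hEP`, and the ONE port
`KatoKuriharaPortThreeAt W 1 v₃` (FLAG `K22-Thm3.13-PORT@3`, construction-shaped, NOT in print at `3`);
NO [S24] fact of any level.  The Kurihara values stay EVIDENCE hypotheses of every record.

## What and why

Parts 1–3 (`KuriharaRecordBSDpThreeLevelTwoEnd[OfFacts|NoRank]`, p298219 / p298767 / p299443) take
the depth-one certificate in n1011-p15's END-m2 currency: discrete logarithms `ψ` onto `ℤ/9` at the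
primes of `n` and `3 · δ̃^{(9)}_n(ψ) ≠ 0`, `3 · δ̃^{(9)}_1(ψ) = 0` in `ℤ/9`.  Route planner 1 (§35.6):
the certificate "is an ORDINARY mod-3 Kurihara number `δ̃_n ≢ 0 (mod 3)` (`δ̃^{(9)} mod 3 = δ̃^{(3)}`)"
— the currency of the END-m1 records and of both engines.  This file makes that reading a theorem:

* `exists_modNine_certificate_of_modThree` — for `n ∈ 𝒩₃(E,3)` prime to the level `N` of the
  parametrisation and `E[3]` irreducible, a mod-`3` certificate (`ψ₃` onto `ℤ/3`,
  `δ̃^{(3)}_n(ψ₃) ≠ 0`, `δ̃^{(3)}_1 = 0`) LIFTS to a mod-`9` one (`ψ₉` onto `ℤ/9` exists since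
  `27 ∣ ℓ − 1`; `δ̃^{(9)}(ψ₉) mod 3 = δ̃^{(3)}(ψ₉ mod 3)` by this seat's `castHom_kuriharaNumber_pow`
  on the `3`-integral symbols `[a/n]⁺` (`IsNewformOf.not_dvd_den_ratPlusSymbol_div`); the choice of
  logarithms is immaterial, `kuriharaNumber_eq_zero_iff_of_surjective`; `3x = 0 ↔ x ≡ 0 (mod 3)`);
* `exists_ne_zero_mem_selmerGroup_three_of_port_of_kolyvaginProduct_levelTwo_of_baseRigidity_modThree`
  — part 1's E2-1 in mod-`3` currency (+ the arithmetic binder `hnN : Nat.Coprime n N`);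
* `bsdp_three_{of_towerSurj,potMult}_of_levelTwoCertificates_of_{baseRigidity,facts}_noRank_modThree`
  — the four `hr`-free END-m2 record corollaries of part 3 in mod-`3` currency: an END-m2 record now
  carries EXACTLY the END-m1 certificate fields (`ψ` onto `ℤ/3`, `δ̃_n(ψ) ≠ 0`, `δ̃_1(ψ) = 0` in
  `ℤ/3`, `δ̃_1 ≢ 0 (mod 27)`) plus `hnN`, with `𝒩₃` / `t = 1` / the port at `t = 1` / the tower.

References: C.-H. Kim, AJM 148 (2026) §1.4.1, §1.4.3, Thm. 1.9 (6), Thm. 3.13 [Kim2022StructureSelmer];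
M. Kurihara, Münster J. Math. 7 (2014) §1.1 [Kurihara2014]; K. Rubin, PCMI 18 (2011) Thm. 2.8.4,
Cor. 2.8.9 [Rubin2011]; K. Kato, Astérisque 295 (2004) Thm. 14.5 (3) [Kato2004Asterisque];
D. Delbourgo (1998) Prop. 4 [Delbourgo1998]; A. Agashe, K. Ribet, W. Stein (2006) Thm. 2.6
[AgasheRibetStein2006]; J. H. Silverman, AEC (2009) X.4.2, X.4.14 [SilvermanAEC2009].
-/

noncomputable section

open scoped Classical NumberField ContRepresentation
open Function Field NumberField IsDedekindDomain IsDedekindDomain.HeightOneSpectrum WeierstrassCurve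
  CongruenceSubgroup
  Literature.NumberTheory.EllipticCurves Literature.NumberTheory.EllipticCurves.ModularForms
  Literature.NumberTheory.EllipticCurves.Rank1Residual
  Literature.NumberTheory.EllipticCurves.AgasheRibetStein2006
  Literature.NumberTheory.GaloisRepresentations
  Literature.NumberTheory.GaloisRepresentations.DiscreteGaloisModule Literature.NumberTheory.GaloisCohomology
  Rat.HeightOneSpectrum
  Summit.BirchSwinnertonDyer.Rank1Residual.Additive Summit.BirchSwinnertonDyer.Rank1Residual.X4
  Summit.BirchSwinnertonDyer.Rank1Residual.Additive.KuriharaReduction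
open Literature.NumberTheory.DiophantineGeometry.Dioph (ratModP)

namespace Summit.BirchSwinnertonDyer.Rank1Residual.GaloisImage.Assembly

/-! ### Lifting a mod-`3` certificate at a `27`-admissible level to the mod-`9` currency -/

/-- **A mod-`3` depth-one certificate lifts to the mod-`9` currency of END-m2.**  `W/ℚ` globally
minimal with `E[3]` irreducible, `D` a parametrisation datum of level `N`, `n ∈ 𝒩₃(E,3)` (so
`27 ∣ ℓ − 1` at its primes) with `gcd(n, N) = 1`; IF for SOME discrete logarithms `ψ` onto `ℤ/3` at
the primes of `n` one has `δ̃^{(3)}_n(ψ) ≠ 0` and `δ̃^{(3)}_1 = 0` in `ℤ/3`, THEN there are discrete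
logarithms `ψ₉` onto `ℤ/9` at the primes of `n` with `3 · δ̃^{(9)}_n(ψ₉) ≠ 0` and `3 · δ̃^{(9)}_1 = 0`
in `ℤ/9`.  (`ψ₉` exists prime by prime, `exists_surjective_unitsHom`; `δ̃^{(9)}(ψ₉) ↦ δ̃^{(3)}(ψ₉
mod 3)` under `ℤ/9 → ℤ/3` because the symbols `[a/n]⁺_{D.f}` are `3`-integral
(`IsNewformOf.not_dvd_den_ratPlusSymbol_div`, `castHom_kuriharaNumber_pow`); non-vanishing does not
depend on the logarithms (`kuriharaNumber_eq_zero_iff_of_surjective`); `3x = 0 ↔ x ≡ 0 (mod 3)`.)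
[cite: Kim2022StructureSelmer, §1.4.1 and §1.4.3 (PDF p. 7)] [cite: Kurihara2014, §1.1 (PDF p. 2)] -/
theorem exists_modNine_certificate_of_modThree
    (W : WeierstrassCurve ℚ) [W.IsElliptic] [W.IsGloballyMinimal]
    (hirr : W.HasIrreducibleModPGaloisRep 3)
    {N : ℕ} [NeZero N] (D : ModularParametrizationData W N)
    {n : ℕ} [NeZero n] (hn : Kato.IsKolyvaginProduct W 3 3 n) (hnN : Nat.Coprime n N)
    (ψ : (ℓ : ℕ) → (ZMod ℓ)ˣ →* Multiplicative (ZMod (3 ^ 1)))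
    (hψ : ∀ ℓ ∈ n.primeFactors, Function.Surjective (ψ ℓ))
    (hcert : kuriharaNumber D.f (3 ^ 1) n ψ ≠ 0) (hzero₁ : kuriharaNumber D.f (3 ^ 1) 1 ψ = 0) :
    ∃ ψ₉ : (ℓ : ℕ) → (ZMod ℓ)ˣ →* Multiplicative (ZMod (3 ^ 2)),
      (∀ ℓ ∈ n.primeFactors, Function.Surjective (ψ₉ ℓ)) ∧
        (3 : ZMod (3 ^ 2)) * kuriharaNumber D.f (3 ^ 2) n ψ₉ ≠ 0 ∧
        (3 : ZMod (3 ^ 2)) * kuriharaNumber D.f (3 ^ 2) 1 ψ₉ = 0 := by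
  haveI : Fact (Nat.Prime 3) := ⟨Nat.prime_three⟩
  -- mod-`9` logarithms at the primes of `n`: `9 ∣ ℓ - 1` since `ℓ ≡ 1 (mod 27)`
  have hlog : ∀ ℓ ∈ n.primeFactors, ∃ φ : (ZMod ℓ)ˣ →* Multiplicative (ZMod (3 ^ 2)),
      Function.Surjective φ := by
    intro ℓ hℓ
    have hK : Kato.IsKolyvaginPrime W 3 3 ℓ := hn.2 ℓ hℓ
    refine exists_surjective_unitsHom hK.prime ?_
    have h27 : 3 ^ 3 ∣ ℓ - 1 := (Nat.modEq_iff_dvd' hK.prime.one_le).mp hK.modEq_one.symm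
    exact (pow_dvd_pow 3 (by norm_num : 2 ≤ 3)).trans h27
  choose! φ hφ using hlog
  -- the reduced logarithms `φ mod 3` are onto as well
  have hφ₃ : ∀ ℓ ∈ n.primeFactors, Function.Surjective
      ((ZMod.castHom (pow_dvd_pow 3 (Nat.le_succ 1)) (ZMod (3 ^ 1))).toAddMonoidHom.toMultiplicative.comp
        (φ ℓ)) := fun ℓ hℓ => surjective_castHom_comp 3 (Nat.le_succ 1) (hφ ℓ hℓ)
  -- the symbols `[a/n]⁺`, `[0]⁺` are `3`-integral
  have hden : ∀ a : (ZMod n)ˣ, ¬ 3 ∣ (ratPlusSymbol D.f (((a : ZMod n).val : ℚ) / n)).den := by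
    intro a
    have h := D.isNewformOf.not_dvd_den_ratPlusSymbol_div (p := 3) (by norm_num) hirr hnN
      ((a : ZMod n).val : ℤ)
    simpa using h
  have hden₁ : ∀ a : (ZMod 1)ˣ, ¬ 3 ∣ (ratPlusSymbol D.f (((a : ZMod 1).val : ℚ) / (1 : ℕ))).den := by
    intro a
    have h := D.isNewformOf.not_dvd_den_ratPlusSymbol_div (p := 3) (by norm_num) hirr
      (Nat.coprime_one_left N) ((a : ZMod 1).val : ℤ)
    simpa using h
  refine ⟨φ, hφ, ?_, ?_⟩
  · -- `3·δ̃^{(9)}_n(φ) = 0` would give `δ̃^{(3)}_n(φ mod 3) = 0`, hence `δ̃^{(3)}_n(ψ) = 0`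
    intro h0
    have h1 := (three_mul_eq_zero_iff_castHom_eq_zero _).mp h0
    rw [castHom_kuriharaNumber_pow D.f 3 (Nat.le_succ 1) n φ hden] at h1
    exact hcert ((kuriharaNumber_eq_zero_iff_of_surjective D.f (3 ^ 1) n hψ hφ₃).mp h1)
  · -- `3·δ̃^{(9)}_1 = 0` from `δ̃^{(3)}_1 = [0]⁺ mod 3 = 0`
    rw [three_mul_eq_zero_iff_castHom_eq_zero, castHom_kuriharaNumber_pow D.f 3 (Nat.le_succ 1) 1 φ
      hden₁, kuriharaNumber_one]
    rw [kuriharaNumber_one] at hzero₁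
    exact hzero₁

/-! ### `Sel₃(E) ≠ 0` and the END-m2 record corollaries in mod-`3` currency -/

/-- **`Sel₃(E) ≠ 0` on a class-A2 row from ONE depth-one Kurihara unit in mod-`3` CURRENCY —
[S24]-FREE.**  Part 1's
`exists_ne_zero_mem_selmerGroup_three_of_port_of_kolyvaginProduct_levelTwo_of_baseRigidity` with the
certificate fields `ψ` onto `ℤ/9`, `3·δ̃^{(9)}_n ≠ 0`, `3·δ̃^{(9)}_1 = 0` REPLACED by the END-m1 /
engine fields `ψ` onto `ℤ/3`, `δ̃^{(3)}_n(ψ) ≠ 0`, `δ̃^{(3)}_1 = 0` and the arithmetic binder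
`hnN : gcd(n, N) = 1` (lift by `exists_modNine_certificate_of_modThree`; `E[3]` irreducible from the
tower).  Same port, same tower, same datum; CLOSES NOTHING.
[cite: Kim2022StructureSelmer, §1.4.3, Thm. 3.13] [cite: Rubin2011, Thm. 2.8.4 and Cor. 2.8.9] -/
theorem exists_ne_zero_mem_selmerGroup_three_of_port_of_kolyvaginProduct_levelTwo_of_baseRigidity_modThree
    (W : WeierstrassCurve ℚ) [W.IsElliptic] [W.IsGloballyMinimal]
    (hadd : haveI : Fact (Nat.Prime 3) := ⟨Nat.prime_three⟩; Addv W 3)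
    (hc3 : ¬ 3 ∣ (W.baseChange ℚ_[3]).localTamagawaNumber ℤ_[3])
    (htower : ∀ m : ℕ, W.HasSurjectiveModNGaloisRep (3 ^ m : ℕ))
    (ht1 : Nat.card {Q : (W.baseChange ℚ_[3]).toAffine.Point // (3 : ℕ) • Q = 0} = 3 ^ 1)
    {N : ℕ} [NeZero N] (D : ModularParametrizationData W N)
    (hcP : ¬ ((3 : ℕ) : ℤ) ∣ D.maninConstant)
    (hper : ∃ u : ℚ, ‖(u : ℚ_[3])‖ = 1 ∧ W.realPeriodRat = u * plusPeriod D.f)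
    (inv : LocalInvariants ℚ 3) (hperf : inv.IsPerfect) (hsum : inv.SumLocalTermEqZero)
    (hcompl : inv.SelmerComplement)
    (hEP : ∀ v : HeightOneSpectrum (𝓞 ℚ), localEulerPoincareCharacteristic (v.adicCompletion ℚ))
    (v₃ : HeightOneSpectrum (𝓞 ℚ)) (hv₃ : ((3 : ℕ) : 𝓞 ℚ) ∈ v₃.asIdeal)
    (hPort : KatoKuriharaPortThreeAt W 1 v₃)
    (n : ℕ) [NeZero n] (hn : Kato.IsKolyvaginProduct W 3 3 n) (hnN : Nat.Coprime n N)
    (hcyc : ∀ (ℓ : ℕ) [Fact ℓ.Prime], ℓ ∣ n →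
      Nat.card {P : ((integralModelInt W).map (Int.castRingHom (ZMod ℓ))).toAffine.Point //
        3 • P = 0} ≤ 3)
    (ψ : (ℓ : ℕ) → (ZMod ℓ)ˣ →* Multiplicative (ZMod (3 ^ 1)))
    (hψ : ∀ ℓ ∈ n.primeFactors, Function.Surjective (ψ ℓ))
    (hcert : kuriharaNumber D.f (3 ^ 1) n ψ ≠ 0)
    (hzero₁ : kuriharaNumber D.f (3 ^ 1) 1 ψ = 0) :
    ∃ x ∈ (W.kummerSelmerStructure ((3 : ℕ) : ℤ)).selmerGroup, x ≠ 0 := by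
  have hsurj : W.HasSurjectiveModNGaloisRep 3 := by simpa using htower 1
  have hirr : W.HasIrreducibleModPGaloisRep 3 :=
    hasIrreducibleModPGaloisRep_of_hasSurjectiveModNGaloisRep W 3 hsurj
  obtain ⟨ψ₉, hψ₉, hcert₉, hzero₉⟩ :=
    exists_modNine_certificate_of_modThree W hirr D hn hnN ψ hψ hcert hzero₁
  exact exists_ne_zero_mem_selmerGroup_three_of_port_of_kolyvaginProduct_levelTwo_of_baseRigidity W
    hadd hc3 htower ht1 D hcP hper inv hperf hsum hcompl hEP v₃ hv₃ hPort n hn hcyc ψ₉ hψ₉ hcert₉ hzero₉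

/-- **END-m2 RECORD COROLLARY, [S24]-FREE, `hr`-FREE, mod-`3` CURRENCY (potentially GOOD rows /
tower form).**  Exactly part 3's
`bsdp_three_of_towerSurj_of_levelTwoCertificates_of_baseRigidity_noRank` with the certificate in the
END-m1 / engine currency: `ψ` onto `ℤ/3` at the primes of `n ∈ 𝒩₃(E,3)`, `δ̃_n(ψ) ≢ 0 (mod 3)`,
`δ̃_1 ≡ 0 (mod 3)`, `δ̃_1 ≢ 0 (mod 27)`, plus `hnN : gcd(n, N) = 1` (arithmetic on a record).
CLOSES NOTHING; values = EVIDENCE.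
[cite: Kim2022StructureSelmer, §1.4.3, Thm. 1.9 (6) and Thm. 3.13] [cite: Rubin2011, Thm. 2.8.4 and Cor. 2.8.9]
[cite: Kato2004Asterisque, Thm. 14.5 (3) (p. 236)] [cite: AgasheRibetStein2006, Thm. 2.6 (p. 619)] -/
theorem bsdp_three_of_towerSurj_of_levelTwoCertificates_of_baseRigidity_noRank_modThree
    (hKatoS : Kato2004.rankZero_padicValNat_sha_le_sub_localTamagawa_of_additive_potGood_of_imageContainsSL2)
    (hDel : Delbourgo1998.prop4_rankZero_pow_dvd_constantCoeff)
    (hGZK : rank_eq_analyticRank_of_analyticRank_le_one) (hmod : hasEntireLFunction_rat)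
    (hmodD : nonempty_modularParametrizationData)
    (hKatoχ : Wuthrich2014.kato_halfEigenCharIdeal_dvd_cyclotomicPrime_of_surjective)
    (h26 : cremona_abs_maninConstant_eq_one_of_level_le)
    (hCT : exists_casselsTate_pairing (K := ℚ))
    (W : WeierstrassCurve ℚ) [W.IsElliptic] [W.IsGloballyMinimal]
    {E₀ : WeierstrassCurve ℤ} (hI : integralModelInt W = E₀)
    (hΔ : (3 : ℤ) ∣ E₀.Δ) (hc₄ : (3 : ℤ) ∣ E₀.c₄)
    (htower : ∀ m : ℕ, W.HasSurjectiveModNGaloisRep (3 ^ m : ℕ))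
    (ht1 : Nat.card {Q : (W.baseChange ℚ_[3]).toAffine.Point // (3 : ℕ) • Q = 0} = 3 ^ 1)
    (htam : ¬ 3 ∣ W.tamagawaProduct)
    {N : ℕ} [NeZero N] (hN : N ≤ 130000) (D : ModularParametrizationData W N)
    (hopt : ∀ z ∈ D.L.lattice, ∃ w ∈ periodLattice D.f, z = D.c * w)
    (inv : LocalInvariants ℚ 3) (hperf : inv.IsPerfect) (hsum : inv.SumLocalTermEqZero)
    (hcompl : inv.SelmerComplement)
    (hEP : ∀ v : HeightOneSpectrum (𝓞 ℚ), localEulerPoincareCharacteristic (v.adicCompletion ℚ))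
    (v₃ : HeightOneSpectrum (𝓞 ℚ)) (hv₃ : ((3 : ℕ) : 𝓞 ℚ) ∈ v₃.asIdeal)
    (hPort : KatoKuriharaPortThreeAt W 1 v₃)
    (n : ℕ) [NeZero n] (hn : Kato.IsKolyvaginProduct W 3 3 n) (hnN : Nat.Coprime n N)
    (hcyc : ∀ (ℓ : ℕ) [Fact ℓ.Prime], ℓ ∣ n →
      Nat.card {P : ((integralModelInt W).map (Int.castRingHom (ZMod ℓ))).toAffine.Point //
        3 • P = 0} ≤ 3)
    (ψ : (ℓ : ℕ) → (ZMod ℓ)ˣ →* Multiplicative (ZMod (3 ^ 1)))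
    (hψ : ∀ ℓ ∈ n.primeFactors, Function.Surjective (ψ ℓ))
    (hcert : kuriharaNumber D.f (3 ^ 1) n ψ ≠ 0)
    (hzero₁ : kuriharaNumber D.f (3 ^ 1) 1 ψ = 0)
    (ψ₂₇ : (ℓ : ℕ) → (ZMod ℓ)ˣ →* Multiplicative (ZMod (3 ^ 3)))
    (hunit₁ : kuriharaNumber D.f (3 ^ 3) 1 ψ₂₇ ≠ 0) :
    BSDp W 3 := by
  have hsurj : W.HasSurjectiveModNGaloisRep 3 := by simpa using htower 1
  have hirr : W.HasIrreducibleModPGaloisRep 3 :=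
    hasIrreducibleModPGaloisRep_of_hasSurjectiveModNGaloisRep W 3 hsurj
  obtain ⟨ψ₉, hψ₉, hcert₉, hzero₉⟩ :=
    exists_modNine_certificate_of_modThree W hirr D hn hnN ψ hψ hcert hzero₁
  exact bsdp_three_of_towerSurj_of_levelTwoCertificates_of_baseRigidity_noRank hKatoS hDel hGZK hmod
    hmodD hKatoχ h26 hCT W hI hΔ hc₄ htower ht1 htam hN D hopt inv hperf hsum hcompl hEP v₃ hv₃ hPort n
    hn hcyc ψ₉ hψ₉ hcert₉ hzero₉ ψ₂₇ hunit₁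

/-- **END-m2 RECORD COROLLARY, [S24]-FREE, `hr`-FREE, mod-`3` CURRENCY (potentially MULTIPLICATIVE
rows).**  Exactly part 3's `bsdp_three_potMult_of_levelTwoCertificates_of_baseRigidity_noRank` with
the certificate in the END-m1 / engine currency (`ψ` onto `ℤ/3`, `δ̃_n(ψ) ≢ 0 (mod 3)`,
`δ̃_1 ≡ 0 (mod 3)`, `δ̃_1 ≢ 0 (mod 27)`) plus `hnN : gcd(n, N) = 1`; the tower stays a binder.
CLOSES NOTHING; values = EVIDENCE.
[cite: Kim2022StructureSelmer, §1.4.3, Thm. 1.9 (6) and Thm. 3.13] [cite: Rubin2011, Thm. 2.8.4 and Cor. 2.8.9]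
[cite: Delbourgo1998, Prop. 4 (p. 144)] [cite: AgasheRibetStein2006, Thm. 2.6 (p. 619)] -/
theorem bsdp_three_potMult_of_levelTwoCertificates_of_baseRigidity_noRank_modThree
    (hKatoS : Kato2004.rankZero_padicValNat_sha_le_sub_localTamagawa_of_additive_potGood_of_imageContainsSL2)
    (hDel : Delbourgo1998.prop4_rankZero_pow_dvd_constantCoeff)
    (hGZK : rank_eq_analyticRank_of_analyticRank_le_one) (hmod : hasEntireLFunction_rat)
    (hmodD : nonempty_modularParametrizationData)
    (hKatoχ : Wuthrich2014.kato_halfEigenCharIdeal_dvd_cyclotomicPrime_of_surjective)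
    (h26 : cremona_abs_maninConstant_eq_one_of_level_le)
    (hCT : exists_casselsTate_pairing (K := ℚ))
    (W : WeierstrassCurve ℚ) [W.IsElliptic] [W.IsGloballyMinimal]
    {E₀ : WeierstrassCurve ℤ} (hI : integralModelInt W = E₀)
    (hΔ : (3 : ℤ) ∣ E₀.Δ) (hc₄ : (3 : ℤ) ∣ E₀.c₄)
    (htower : ∀ m : ℕ, W.HasSurjectiveModNGaloisRep (3 ^ m : ℕ)) (hjneg : padicValRat 3 W.j < 0)
    (hc3 : ¬ 3 ∣ (W.baseChange ℚ_[3]).localTamagawaNumber ℤ_[3])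
    (ht1 : Nat.card {Q : (W.baseChange ℚ_[3]).toAffine.Point // (3 : ℕ) • Q = 0} = 3 ^ 1)
    {N : ℕ} [NeZero N] (hN : N ≤ 130000) (D : ModularParametrizationData W N)
    (hopt : ∀ z ∈ D.L.lattice, ∃ w ∈ periodLattice D.f, z = D.c * w)
    (inv : LocalInvariants ℚ 3) (hperf : inv.IsPerfect) (hsum : inv.SumLocalTermEqZero)
    (hcompl : inv.SelmerComplement)
    (hEP : ∀ v : HeightOneSpectrum (𝓞 ℚ), localEulerPoincareCharacteristic (v.adicCompletion ℚ))
    (v₃ : HeightOneSpectrum (𝓞 ℚ)) (hv₃ : ((3 : ℕ) : 𝓞 ℚ) ∈ v₃.asIdeal)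
    (hPort : KatoKuriharaPortThreeAt W 1 v₃)
    (n : ℕ) [NeZero n] (hn : Kato.IsKolyvaginProduct W 3 3 n) (hnN : Nat.Coprime n N)
    (hcyc : ∀ (ℓ : ℕ) [Fact ℓ.Prime], ℓ ∣ n →
      Nat.card {P : ((integralModelInt W).map (Int.castRingHom (ZMod ℓ))).toAffine.Point //
        3 • P = 0} ≤ 3)
    (ψ : (ℓ : ℕ) → (ZMod ℓ)ˣ →* Multiplicative (ZMod (3 ^ 1)))
    (hψ : ∀ ℓ ∈ n.primeFactors, Function.Surjective (ψ ℓ))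
    (hcert : kuriharaNumber D.f (3 ^ 1) n ψ ≠ 0)
    (hzero₁ : kuriharaNumber D.f (3 ^ 1) 1 ψ = 0)
    (ψ₂₇ : (ℓ : ℕ) → (ZMod ℓ)ˣ →* Multiplicative (ZMod (3 ^ 3)))
    (hunit₁ : kuriharaNumber D.f (3 ^ 3) 1 ψ₂₇ ≠ 0) :
    BSDp W 3 := by
  have hsurj : W.HasSurjectiveModNGaloisRep 3 := by simpa using htower 1
  have hirr : W.HasIrreducibleModPGaloisRep 3 :=
    hasIrreducibleModPGaloisRep_of_hasSurjectiveModNGaloisRep W 3 hsurj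
  obtain ⟨ψ₉, hψ₉, hcert₉, hzero₉⟩ :=
    exists_modNine_certificate_of_modThree W hirr D hn hnN ψ hψ hcert hzero₁
  exact bsdp_three_potMult_of_levelTwoCertificates_of_baseRigidity_noRank hKatoS hDel hGZK hmod hmodD
    hKatoχ h26 hCT W hI hΔ hc₄ htower hjneg hc3 ht1 hN D hopt inv hperf hsum hcompl hEP v₃ hv₃ hPort n hn
    hcyc ψ₉ hψ₉ hcert₉ hzero₉ ψ₂₇ hunit₁

/-- **END-m2 RECORD COROLLARY, NAMED-FACTS form, `hr`-FREE, mod-`3` CURRENCY (potentially GOOD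
rows / tower form)** — part 3's `bsdp_three_of_towerSurj_of_levelTwoCertificates_of_facts_noRank` with
the certificate in the END-m1 / engine currency plus `hnN`.  CLOSES NOTHING; values = EVIDENCE.
[cite: Kim2022StructureSelmer, §1.4.3, Thm. 1.9 (6) and Thm. 3.13] [cite: MilneADT2006, Ch. I, Thm. 4.10]
[cite: Kato2004Asterisque, Thm. 14.5 (3) (p. 236)] [cite: AgasheRibetStein2006, Thm. 2.6 (p. 619)] -/
theorem bsdp_three_of_towerSurj_of_levelTwoCertificates_of_facts_noRank_modThree
    (hKatoS : Kato2004.rankZero_padicValNat_sha_le_sub_localTamagawa_of_additive_potGood_of_imageContainsSL2)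
    (hDel : Delbourgo1998.prop4_rankZero_pow_dvd_constantCoeff)
    (hGZK : rank_eq_analyticRank_of_analyticRank_le_one) (hmod : hasEntireLFunction_rat)
    (hmodD : nonempty_modularParametrizationData)
    (hKatoχ : Wuthrich2014.kato_halfEigenCharIdeal_dvd_cyclotomicPrime_of_surjective)
    (h26 : cremona_abs_maninConstant_eq_one_of_level_le)
    (hCT : exists_casselsTate_pairing (K := ℚ))
    (W : WeierstrassCurve ℚ) [W.IsElliptic] [W.IsGloballyMinimal]
    {E₀ : WeierstrassCurve ℤ} (hI : integralModelInt W = E₀)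
    (hΔ : (3 : ℤ) ∣ E₀.Δ) (hc₄ : (3 : ℤ) ∣ E₀.c₄)
    (htower : ∀ m : ℕ, W.HasSurjectiveModNGaloisRep (3 ^ m : ℕ))
    (ht1 : Nat.card {Q : (W.baseChange ℚ_[3]).toAffine.Point // (3 : ℕ) • Q = 0} = 3 ^ 1)
    (htam : ¬ 3 ∣ W.tamagawaProduct)
    {N : ℕ} [NeZero N] (hN : N ≤ 130000) (D : ModularParametrizationData W N)
    (hopt : ∀ z ∈ D.L.lattice, ∃ w ∈ periodLattice D.f, z = D.c * w)
    (hPT : poitouTate_selmerStructure_duality ℚ)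
    (hEP : ∀ v : HeightOneSpectrum (𝓞 ℚ), localEulerPoincareCharacteristic (v.adicCompletion ℚ))
    (v₃ : HeightOneSpectrum (𝓞 ℚ)) (hv₃ : ((3 : ℕ) : 𝓞 ℚ) ∈ v₃.asIdeal)
    (hPort : KatoKuriharaPortThreeAt W 1 v₃)
    (n : ℕ) [NeZero n] (hn : Kato.IsKolyvaginProduct W 3 3 n) (hnN : Nat.Coprime n N)
    (hcyc : ∀ (ℓ : ℕ) [Fact ℓ.Prime], ℓ ∣ n →
      Nat.card {P : ((integralModelInt W).map (Int.castRingHom (ZMod ℓ))).toAffine.Point //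
        3 • P = 0} ≤ 3)
    (ψ : (ℓ : ℕ) → (ZMod ℓ)ˣ →* Multiplicative (ZMod (3 ^ 1)))
    (hψ : ∀ ℓ ∈ n.primeFactors, Function.Surjective (ψ ℓ))
    (hcert : kuriharaNumber D.f (3 ^ 1) n ψ ≠ 0)
    (hzero₁ : kuriharaNumber D.f (3 ^ 1) 1 ψ = 0)
    (ψ₂₇ : (ℓ : ℕ) → (ZMod ℓ)ˣ →* Multiplicative (ZMod (3 ^ 3)))
    (hunit₁ : kuriharaNumber D.f (3 ^ 3) 1 ψ₂₇ ≠ 0) :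
    BSDp W 3 := by
  have hsurj : W.HasSurjectiveModNGaloisRep 3 := by simpa using htower 1
  have hirr : W.HasIrreducibleModPGaloisRep 3 :=
    hasIrreducibleModPGaloisRep_of_hasSurjectiveModNGaloisRep W 3 hsurj
  obtain ⟨ψ₉, hψ₉, hcert₉, hzero₉⟩ :=
    exists_modNine_certificate_of_modThree W hirr D hn hnN ψ hψ hcert hzero₁
  exact bsdp_three_of_towerSurj_of_levelTwoCertificates_of_facts_noRank hKatoS hDel hGZK hmod hmodD
    hKatoχ h26 hCT W hI hΔ hc₄ htower ht1 htam hN D hopt hPT hEP v₃ hv₃ hPort n hn hcyc ψ₉ hψ₉ hcert₉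
    hzero₉ ψ₂₇ hunit₁

/-- **END-m2 RECORD COROLLARY, NAMED-FACTS form, `hr`-FREE, mod-`3` CURRENCY (potentially
MULTIPLICATIVE rows)** — part 3's `bsdp_three_potMult_of_levelTwoCertificates_of_facts_noRank` with
the certificate in the END-m1 / engine currency plus `hnN`.  CLOSES NOTHING; values = EVIDENCE.
[cite: Kim2022StructureSelmer, §1.4.3, Thm. 1.9 (6) and Thm. 3.13] [cite: MilneADT2006, Ch. I, Thm. 4.10]
[cite: Delbourgo1998, Prop. 4 (p. 144)] [cite: AgasheRibetStein2006, Thm. 2.6 (p. 619)] -/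
theorem bsdp_three_potMult_of_levelTwoCertificates_of_facts_noRank_modThree
    (hKatoS : Kato2004.rankZero_padicValNat_sha_le_sub_localTamagawa_of_additive_potGood_of_imageContainsSL2)
    (hDel : Delbourgo1998.prop4_rankZero_pow_dvd_constantCoeff)
    (hGZK : rank_eq_analyticRank_of_analyticRank_le_one) (hmod : hasEntireLFunction_rat)
    (hmodD : nonempty_modularParametrizationData)
    (hKatoχ : Wuthrich2014.kato_halfEigenCharIdeal_dvd_cyclotomicPrime_of_surjective)
    (h26 : cremona_abs_maninConstant_eq_one_of_level_le)
    (hCT : exists_casselsTate_pairing (K := ℚ))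
    (W : WeierstrassCurve ℚ) [W.IsElliptic] [W.IsGloballyMinimal]
    {E₀ : WeierstrassCurve ℤ} (hI : integralModelInt W = E₀)
    (hΔ : (3 : ℤ) ∣ E₀.Δ) (hc₄ : (3 : ℤ) ∣ E₀.c₄)
    (htower : ∀ m : ℕ, W.HasSurjectiveModNGaloisRep (3 ^ m : ℕ)) (hjneg : padicValRat 3 W.j < 0)
    (hc3 : ¬ 3 ∣ (W.baseChange ℚ_[3]).localTamagawaNumber ℤ_[3])
    (ht1 : Nat.card {Q : (W.baseChange ℚ_[3]).toAffine.Point // (3 : ℕ) • Q = 0} = 3 ^ 1)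
    {N : ℕ} [NeZero N] (hN : N ≤ 130000) (D : ModularParametrizationData W N)
    (hopt : ∀ z ∈ D.L.lattice, ∃ w ∈ periodLattice D.f, z = D.c * w)
    (hPT : poitouTate_selmerStructure_duality ℚ)
    (hEP : ∀ v : HeightOneSpectrum (𝓞 ℚ), localEulerPoincareCharacteristic (v.adicCompletion ℚ))
    (v₃ : HeightOneSpectrum (𝓞 ℚ)) (hv₃ : ((3 : ℕ) : 𝓞 ℚ) ∈ v₃.asIdeal)
    (hPort : KatoKuriharaPortThreeAt W 1 v₃)
    (n : ℕ) [NeZero n] (hn : Kato.IsKolyvaginProduct W 3 3 n) (hnN : Nat.Coprime n N)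
    (hcyc : ∀ (ℓ : ℕ) [Fact ℓ.Prime], ℓ ∣ n →
      Nat.card {P : ((integralModelInt W).map (Int.castRingHom (ZMod ℓ))).toAffine.Point //
        3 • P = 0} ≤ 3)
    (ψ : (ℓ : ℕ) → (ZMod ℓ)ˣ →* Multiplicative (ZMod (3 ^ 1)))
    (hψ : ∀ ℓ ∈ n.primeFactors, Function.Surjective (ψ ℓ))
    (hcert : kuriharaNumber D.f (3 ^ 1) n ψ ≠ 0)
    (hzero₁ : kuriharaNumber D.f (3 ^ 1) 1 ψ = 0)
    (ψ₂₇ : (ℓ : ℕ) → (ZMod ℓ)ˣ →* Multiplicative (ZMod (3 ^ 3)))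
    (hunit₁ : kuriharaNumber D.f (3 ^ 3) 1 ψ₂₇ ≠ 0) :
    BSDp W 3 := by
  have hsurj : W.HasSurjectiveModNGaloisRep 3 := by simpa using htower 1
  have hirr : W.HasIrreducibleModPGaloisRep 3 :=
    hasIrreducibleModPGaloisRep_of_hasSurjectiveModNGaloisRep W 3 hsurj
  obtain ⟨ψ₉, hψ₉, hcert₉, hzero₉⟩ :=
    exists_modNine_certificate_of_modThree W hirr D hn hnN ψ hψ hcert hzero₁
  exact bsdp_three_potMult_of_levelTwoCertificates_of_facts_noRank hKatoS hDel hGZK hmod hmodD hKatoχ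
    h26 hCT W hI hΔ hc₄ htower hjneg hc3 ht1 hN D hopt hPT hEP v₃ hv₃ hPort n hn hcyc ψ₉ hψ₉ hcert₉
    hzero₉ ψ₂₇ hunit₁

end Summit.BirchSwinnertonDyer.Rank1Residual.GaloisImage.Assembly

end
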